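import Summits.QuantumFields.YangMills.Theorems.AlphaInputsT3ACv3StartStraddle
import Summits.QuantumFields.YangMills.Theorems.AlphaInputsT3ACv3StartShellSat
import Summits.QuantumFields.YangMills.Theorems.AlphaInputsT3ACv3StartSystemCoverage
import HarnessLib

/-!
# `AlphaInputsT3ACv3StartLatticeKnit` — START v3.1 for the (FL) `hLift` binder, row (S5)-4 knit: **FOUR OF THE SEVEN LATTICE BINDERS OF `startT3_cert` DISCHARGED** from ★w2 g2's
# generic lattice theorems `hbox_startSys`∕`hcov_startSys` (IsBall∕InBall∕C abstract): ★`hbox_canon` and ★`hcov_canon` at the constrained, non-deep plaquettes of the canonical balls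
# (`C := (· ∈ plaqsIn 0 Ω)`, `InBall := BallBond · RbT`; straddle rows by `deep_of_top`∕`deep_of_bot`), and their SHELL twins ★`hbox_shell`∕★`hcov_shell` at `ShellPlaq` (`InBall := ⊥`,
# straddle rows vacuous by `not_shellPlaq_of_top`∕`_of_bot`, `hC` by `shellPlaq_mem_plaqsIn`) — under the region's saturation rows and `hlam` (one longitudinal direction, d = 3) —
# lane `pub-balaban3d` ∕ cell `ym3-torus`, seat `ym-ust-19936-w1` (g2, LEAD)

WHY (PROGRESS 8).  With `htwo_of_sat` (✓) this leaves exactly `hsep`∕`hsep_sh` (★w5 g2) and the three (S6) numeral rows open on the START side of M22.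
WHAT IS HERE: `not_deep_bot` (no plaquette is deep for `InBall := ⊥`), ★`hbox_canon`, ★`hbox_shell`, ★`hcov_canon`, ★`hcov_shell`.
HONEST FRAMING.  Knit over ★w2's theorems; (FL)∕`hLift` NOT proved; count-neutral helper toward R3 2′ (items 19936∕19935); registry untouched; nothing about d = 4, the continuum, or a
mass gap; YM₃ on T³ is rung R3, not Clay.

References: T. Bałaban, Commun. Math. Phys. 102 (1985) 277–309 [Balaban1985Variational] ((11)–(14) pp.279–280); Commun. Math. Phys. 102 (1985) 255–275 [Balaban1985UV3] ((39) p.266).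
-/

set_option autoImplicit false

noncomputable section

open scoped Matrix.Norms.L2Operator

namespace Summit.QuantumFields.YangMills.Theorems.TubeStart

open Literature.MathematicalPhysics.QuantumFieldTheory.Balaban1983to89
open Literature.MathematicalPhysics.QuantumFieldTheory.Balaban1983to89.BlockAveragingSectionAction (iterSec)
open Literature.MathematicalPhysics.QuantumFieldTheory.Balaban1983to89.B5Eq118OneStroke (iterBlockOf)
open Literature.MathematicalPhysics.QuantumFieldTheory.Balaban1983to89.B10Eq38TorusDomains (toFine plaqsIn)
open Summit.QuantumFields.Balaban3D.Carriers
open Summit.QuantumFields.YangMills.Theorems.ModelBox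

variable {P : Params} {n : Type*} [Fintype n] [DecidableEq n] [Nonempty n] {k : ℕ} (Ω : Set (Site P 0)) (V : GaugeField P k (Matrix.specialUnitaryGroup n ℂ))

/-- No plaquette is deep for the empty ball-bond predicate. [folklore] -/
theorem not_deep_bot (IsBall : Site P 0 → Prop) (q : Plaq P 0) : ¬ Plaq.Deep IsBall (fun _ _ => False) q :=
  fun ⟨_, _, h⟩ => h ⟨q.src, q.μ⟩ (Or.inl rfl)

open Classical in
/-- **★ (hbox) AT THE CANONICAL BALLS** — the binder `hbox` of `dist1_plaqHol_startSys_le`∕`startT3_cert`, from ★w2's `hbox_startSys` with the straddle rows discharged by `deep_of_top`∕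
`deep_of_bot`. [cite: Balaban1985Variational, (11)–(14) pp.279–280] -/
theorem hbox_canon (hk1 : k + 1 ≤ P.m + P.K) (hsat : ∀ x x' : Site P 0, coarsen k x = coarsen k x' → (x ∈ Ω ↔ x' ∈ Ω)) (htf : ∀ z : Site P k, coarsen k (toFine k z) = z)
    (hsat1 : ∀ z z' : Site P k, blockOf z = blockOf z' → (CellIn Ω k z ↔ CellIn Ω k z')) (lam : Plaq P k → Fin P.d) (hlam : ∀ Q j, ¬ (j = Q.μ ∨ j = Q.ν) ↔ j = lam Q)
    (hL : 16 ≤ P.L ^ k) (hN : 4 * P.L ^ k ≤ P.sitesPerDir 0)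
    (hwin : ∀ Q : Plaq P k, Q ∈ plaqsIn k Ω → ‖((wordQ k V Q : Matrix.specialUnitaryGroup n ℂ) : Matrix n n ℂ) - 1‖ ≤ 1 / 4 ∧
      (Fintype.card n : ℝ) * ‖((wordQ k V Q : Matrix.specialUnitaryGroup n ℂ) : Matrix n n ℂ) - 1‖ < Real.pi) :
    ∀ Q, IsTubeΩ k Ω Q → ∀ q : Plaq P 0, q ∈ plaqsIn 0 Ω → ¬ Plaq.Deep (IsBallΩ k Ω) (fun v b => BallBond v (RbT P k) b) q →
      (∃ b, Plaq.HasBond q b ∧ TubeActive V (RtT P k) (FpOf k V) (tfOf k Ω) (IsTubeΩ k Ω) Q b) →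
      ∃ u : Fin P.d → ℤ, q.src = boxSite (cornerSite k Q.src Q.μ Q.ν) u ∧ InTube Q.μ Q.ν (RtT P k) (P.L ^ k / 2) u ∧ InTube Q.μ Q.ν (RtT P k) (P.L ^ k / 2) (u + e q.μ) ∧
        InTube Q.μ Q.ν (RtT P k) (P.L ^ k / 2) (u + e q.ν) ∧ InTube Q.μ Q.ν (RtT P k) (P.L ^ k / 2) (u + e q.μ + e q.ν) := by
  have hk : k ≤ P.m + P.K := by omega
  refine hbox_startSys (V := V) (IsBall := IsBallΩ k Ω) (InBall := fun v b => BallBond v (RbT P k) b) (C := fun q => q ∈ plaqsIn 0 Ω) hk1 Ω hsat htf hsat1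
    (fun _ h => h) lam hlam hL hN hwin ?_ ?_
  · intro Q hQ htop q _ ⟨u, hu, hul, hsrc, _⟩
    exact deep_of_top Ω Q (lam Q) (hlam Q) hQ htop q hu hul hsrc
  · intro Q hQ hbot q _ ⟨u, hu, hul, hsrc, _⟩
    exact deep_of_bot Ω Q (lam Q) (hlam Q) hk hQ hbot q hu hul hsrc

open Classical in
/-- **★ (hbox) ON THE SHELL** — the binder `hbox_sh` of `startT3_cert`, from ★w2's `hbox_startSys` at `C := ShellPlaq`, `InBall := ⊥` (straddle rows vacuous). [cite: Balaban1985Variational, (11)–(14) pp.279–280] -/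
theorem hbox_shell (hk1 : k + 1 ≤ P.m + P.K) (hsat : ∀ x x' : Site P 0, coarsen k x = coarsen k x' → (x ∈ Ω ↔ x' ∈ Ω)) (htf : ∀ z : Site P k, coarsen k (toFine k z) = z)
    (hsat1 : ∀ z z' : Site P k, blockOf z = blockOf z' → (CellIn Ω k z ↔ CellIn Ω k z')) (hsatI : ∀ x : Site P 0, x ∈ Ω ↔ toFine k (iterBlockOf k x) ∈ Ω)
    (lam : Plaq P k → Fin P.d) (hlam : ∀ Q j, ¬ (j = Q.μ ∨ j = Q.ν) ↔ j = lam Q) (hL : 16 ≤ P.L ^ k) (hN : 4 * P.L ^ k ≤ P.sitesPerDir 0)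
    (hNk : P.sitesPerDir 0 = P.sitesPerDir k * P.L ^ k)
    (hwin : ∀ Q : Plaq P k, Q ∈ plaqsIn k Ω → ‖((wordQ k V Q : Matrix.specialUnitaryGroup n ℂ) : Matrix n n ℂ) - 1‖ ≤ 1 / 4 ∧
      (Fintype.card n : ℝ) * ‖((wordQ k V Q : Matrix.specialUnitaryGroup n ℂ) : Matrix n n ℂ) - 1‖ < Real.pi) :
    ∀ Q, IsTubeΩ k Ω Q → ∀ q : Plaq P 0, ShellPlaq k Ω q → (∃ b, Plaq.HasBond q b ∧ TubeActive V (RtT P k) (FpOf k V) (tfOf k Ω) (IsTubeΩ k Ω) Q b) →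
      ∃ u : Fin P.d → ℤ, q.src = boxSite (cornerSite k Q.src Q.μ Q.ν) u ∧ InTube Q.μ Q.ν (RtT P k) (P.L ^ k / 2) u ∧ InTube Q.μ Q.ν (RtT P k) (P.L ^ k / 2) (u + e q.μ) ∧
        InTube Q.μ Q.ν (RtT P k) (P.L ^ k / 2) (u + e q.ν) ∧ InTube Q.μ Q.ν (RtT P k) (P.L ^ k / 2) (u + e q.μ + e q.ν) := by
  have hk : k ≤ P.m + P.K := by omega
  have hRL : 2 * RbT P k + 1 ≤ P.L ^ k := two_mul_RbT_add_one_le P k hL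
  have hNb : 2 * RbT P k + 1 ≤ P.sitesPerDir 0 := by omega
  have hRL2 : RbT P k + 2 ≤ P.L ^ k := by unfold RbT rT at *; omega
  intro Q hQ q hq hact
  refine hbox_startSys (V := V) (IsBall := IsBallΩ k Ω) (InBall := fun _ _ => False) (C := ShellPlaq k Ω) hk1 Ω hsat htf hsat1
    (fun q h => shellPlaq_mem_plaqsIn hk hsatI hRL2 q h) lam hlam hL hN hwin ?_ ?_ Q hQ q hq (not_deep_bot _ q) hact
  · intro Q hQ htop q hCq ⟨u, hu, hul, hsrc, _⟩
    exact absurd hCq (not_shellPlaq_of_top Ω Q (lam Q) (hlam Q) hNk hRL hNb q hu hul hsrc)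
  · intro Q hQ hbot q hCq ⟨u, hu, hul, hsrc, _⟩
    exact absurd hCq (not_shellPlaq_of_bot Ω Q (lam Q) (hlam Q) hk hNk hRL hNb q hu hul hsrc)

open Classical in
/-- **★ (hcov) AT THE CANONICAL BALLS** — the binder `hcov` of `startT3_cert` (★w2's `hcov_startSys`, verbatim). [cite: Balaban1985Variational, (11)–(14) pp.279–280] -/
theorem hcov_canon (hk : k ≤ P.m + P.K) (hsat : ∀ x x' : Site P 0, coarsen k x = coarsen k x' → (x ∈ Ω ↔ x' ∈ Ω)) (htf : ∀ z : Site P k, coarsen k (toFine k z) = z)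
    (hL : 16 ≤ P.L ^ k) (hN : 4 * P.L ^ k ≤ P.sitesPerDir 0)
    (hwin : ∀ Q : Plaq P k, Q ∈ plaqsIn k Ω → ‖((wordQ k V Q : Matrix.specialUnitaryGroup n ℂ) : Matrix n n ℂ) - 1‖ ≤ 1 / 4 ∧
      (Fintype.card n : ℝ) * ‖((wordQ k V Q : Matrix.specialUnitaryGroup n ℂ) : Matrix n n ℂ) - 1‖ < Real.pi) :
    ∀ q : Plaq P 0, q ∈ plaqsIn 0 Ω → ¬ Plaq.Deep (IsBallΩ k Ω) (fun v b => BallBond v (RbT P k) b) q → GaugeField.plaqHol (iterSec k V) q ≠ 1 →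
      ∃ Q b, Plaq.HasBond q b ∧ TubeActive V (RtT P k) (FpOf k V) (tfOf k Ω) (IsTubeΩ k Ω) Q b :=
  hcov_startSys (V := V) (IsBall := IsBallΩ k Ω) (InBall := fun v b => BallBond v (RbT P k) b) (C := fun q => q ∈ plaqsIn 0 Ω) hk Ω hsat htf (fun _ h => h) hL hN hwin

open Classical in
/-- **★ (hcov) ON THE SHELL** — the binder `hcov_sh` of `startT3_cert` (★w2's `hcov_startSys` at `C := ShellPlaq`, `InBall := ⊥`). [cite: Balaban1985Variational, (11)–(14) pp.279–280] -/
theorem hcov_shell (hk : k ≤ P.m + P.K) (hsat : ∀ x x' : Site P 0, coarsen k x = coarsen k x' → (x ∈ Ω ↔ x' ∈ Ω)) (htf : ∀ z : Site P k, coarsen k (toFine k z) = z)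
    (hsatI : ∀ x : Site P 0, x ∈ Ω ↔ toFine k (iterBlockOf k x) ∈ Ω) (hL : 16 ≤ P.L ^ k) (hN : 4 * P.L ^ k ≤ P.sitesPerDir 0)
    (hwin : ∀ Q : Plaq P k, Q ∈ plaqsIn k Ω → ‖((wordQ k V Q : Matrix.specialUnitaryGroup n ℂ) : Matrix n n ℂ) - 1‖ ≤ 1 / 4 ∧
      (Fintype.card n : ℝ) * ‖((wordQ k V Q : Matrix.specialUnitaryGroup n ℂ) : Matrix n n ℂ) - 1‖ < Real.pi) :
    ∀ q : Plaq P 0, ShellPlaq k Ω q → GaugeField.plaqHol (iterSec k V) q ≠ 1 →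
      ∃ Q b, Plaq.HasBond q b ∧ TubeActive V (RtT P k) (FpOf k V) (tfOf k Ω) (IsTubeΩ k Ω) Q b := by
  have hRL2 : RbT P k + 2 ≤ P.L ^ k := by unfold RbT rT; omega
  intro q hq hne
  exact hcov_startSys (V := V) (IsBall := IsBallΩ k Ω) (InBall := fun _ _ => False) (C := ShellPlaq k Ω) hk Ω hsat htf
    (fun q h => shellPlaq_mem_plaqsIn hk hsatI hRL2 q h) hL hN hwin q hq (not_deep_bot _ q) hne

end Summit.QuantumFields.YangMills.Theorems.TubeStart

end
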